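import Literature.Analysis.FunctionSpaces.TorusFourierCalculus
import Literature.Analysis.FunctionSpaces.Complexify
import Literature.Analysis.FunctionSpaces.TorusCalculusProofs
import Literature.Analysis.FunctionSpaces.TorusFluidGlueProofs

/-!
# The coercivity lemma behind "no finite stock is first-order sufficient"
# (crux `BaireTransfer.RobustLoudUpgrade`, stmt-AnomalousDissipation-1144; STRATEGY-CENSUS W2 / S3, lead c10)

A `--supports` file for the crux item.  The strategist census of this crux (tree
`Cruxes/RobustLoudUpgrade/STRATEGY-CENSUS.md`, §0 (W2) and §Strengthen (S3)) records, in prose, the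
quantitative reason why no finite stock `S₀ = box K` of perturbation modes makes every degenerate loud
steady witness first-order VISIBLE: a neutral mode of the linearisation that has no Fourier support in
`box K = {k : |kᵢ| ≤ K ∀ i}` must oscillate at frequencies `≥ K+1`, so the energy identity of the
linearised problem forces the strain Reynolds number `‖(∇u₀)_sym‖_∞ /(4π²ν)` of the witness above
`(K+1)²` — and that number is unbounded on every `LOUD_j(S,E,ε)` (the viscosity is free below the
level).  This file kernel-checks the analytic core of that remark:

* §1 `highMode_poincare` — the HIGH-MODE POINCARÉ INEQUALITY on `T^d`: if the Fourier coefficients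
  of a smooth real vector field `v` vanish on `box K`, then `4π²(K+1)² ∫‖v‖² ≤ ‖∇v‖₂²` (Parseval and
  `‖∇v‖₂² = 4π² ∑ |k|²‖v̂(k)‖²`, both in tree: `Torus.tsum_enorm_sq_mFourierCoeff_euclidean`,
  `Torus.tsum_freqNormSq_mul_enorm_sq_mFourierCoeff_complexify`);
* §2 `coercivity_of_energy_le` — the abstract COERCIVITY COROLLARY: if moreover
  `ν‖∇v‖₂² ≤ M ∫‖v‖²` for some `ν ≥ 0` (the shape of the energy identity of a neutral mode, `M` an
  `L^∞` bound of the symmetric velocity gradient of the base flow) and `v ≠ 0` in `L²`, then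
  `4π²ν(K+1)² ≤ M`.

* §3 the NAVIER–STOKES INSTANCE for real neutral modes: a smooth divergence-free `v` solving the
  linearised steady equation `νΔv − (u₀·∇)v − (v·∇)u₀ − ∇q = 0` at a smooth divergence-free base flow
  `u₀` satisfies the energy identity `ν‖∇v‖₂² = −∫⟪(v·∇)u₀, v⟫` (`linearised_energy_identity`:
  transport term and pressure drop out by incompressibility), hence `ν‖∇v‖₂² ≤ M∫‖v‖²` for any
  one-sided strain bound `⟪Du₀(x)ξ, ξ⟫ ≥ −M‖ξ‖²` (`linearised_energy_le`), and so a NON-ZERO neutral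
  mode with no Fourier modes in `box K` forces `4π²ν(K+1)² ≤ M` (`neutralMode_strain_ge`) — verbatim
  the census statement, for the forward kernel (the adjoint kernel `νΔψ + (u₀·∇)ψ − (Du₀)ᵀψ − ∇q' = 0`
  has the same energy identity, the tree has no adjoint vocabulary yet; complex neutral modes
  `Torus.LinNSResolventRel ν u₀ 0 w 0` reduce to real ones coordinatewise since `L(ν,u₀)` is real).

References: Grafakos, *Classical Fourier Analysis* (2014) Prop. 3.2.7 (3) (Parseval), Prop. 3.2.6 (8);
Foias–Temam, LNM 565 (1976) p. 26 (`m ≥ m₁(k,ν)`); the census file above.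
-/

-- `Summit.<Summit>.<Problem>` is the tree's mandated summit-side namespace (CONVENTIONS §2); for this
-- single-conjunct summit the two coincide, so the duplicate is deliberate.
set_option linter.dupNamespace false

noncomputable section

open scoped BigOperators Topology ENNReal RealInnerProductSpace
open Filter Set Function TopologicalSpace MeasureTheory UnitAddTorus

namespace Summit.AnomalousDissipation.AnomalousDissipation.Theorems.RobustLoudUpgrade.Coercivity

open Literature.Analysis.FunctionSpaces Literature.Analysis.FunctionSpaces.Torus

variable {d : Type*} [Fintype d] [DecidableEq d]

/-! ## §1 High-mode Poincaré inequality -/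

omit [DecidableEq d] in
/-- A frequency outside `box K` has squared Euclidean length at least `(K+1)²`. [folklore] -/
theorem sq_succ_le_freqNormSq {K : ℕ} {k : d → ℤ} (hk : ¬ ∀ i, |k i| ≤ K) :
    ((K : ℝ) + 1) ^ 2 ≤ freqNormSq k := by
  push Not at hk
  obtain ⟨i, hi⟩ := hk
  -- `K + 1 ≤ |k i|` in `ℤ`, hence `(K+1)² ≤ (k i)²` in `ℝ`
  have h1 : ((K : ℤ) + 1) ≤ |k i| := hi
  have h2 : ((K : ℝ) + 1) ≤ |(k i : ℝ)| := by
    have : (((K : ℤ) + 1 : ℤ) : ℝ) ≤ ((|k i| : ℤ) : ℝ) := by exact_mod_cast h1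
    simpa [Int.cast_abs] using this
  have h3 : ((K : ℝ) + 1) ^ 2 ≤ (k i : ℝ) ^ 2 := by
    calc ((K : ℝ) + 1) ^ 2 ≤ |(k i : ℝ)| ^ 2 := pow_le_pow_left₀ (by positivity) h2 2
      _ = (k i : ℝ) ^ 2 := sq_abs _
  calc ((K : ℝ) + 1) ^ 2 ≤ (k i : ℝ) ^ 2 := h3
    _ ≤ freqNormSq k := by
        rw [freqNormSq]
        exact Finset.single_le_sum (f := fun j => (k j : ℝ) ^ 2) (fun j _ => sq_nonneg _)
          (Finset.mem_univ i)

/-- **High-mode Poincaré inequality on `T^d`.**  If the Fourier coefficients of a smooth real vector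
field `v` vanish on the box `{k : |kᵢ| ≤ K ∀ i}`, then `4π²(K+1)² ∫‖v‖² ≤ ‖∇v‖₂²` (Parseval and the
spectral form of `‖∇v‖₂²`; the case `K = 0` with only `v̂(0) = 0` is the usual Poincaré inequality for
mean-zero fields). [folklore] -/
theorem highMode_poincare {v : UnitAddTorus d → EuclideanSpace ℝ d} (hv : IsSmooth v) (K : ℕ)
    (hK : ∀ k : d → ℤ, (∀ i, |k i| ≤ K) → mFourierCoeff (EuclideanSpace.complexify ∘ v) k = 0) :
    4 * Real.pi ^ 2 * ((K : ℝ) + 1) ^ 2 * ∫ x, ‖v x‖ ^ 2 ≤ gradNormSq v := by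
  set g : UnitAddTorus d → EuclideanSpace ℂ d := EuclideanSpace.complexify ∘ v with hg_def
  have hg : IsSmooth g := hv.complexify_comp
  -- Parseval for `g`, with `‖g x‖ = ‖v x‖`
  have hP : ∑' k, ‖mFourierCoeff g k‖ₑ ^ 2 = ENNReal.ofReal (∫ x, ‖v x‖ ^ 2) := by
    rw [tsum_enorm_sq_mFourierCoeff_euclidean hg.continuous]
    congr 1
    refine integral_congr_ae (ae_of_all _ fun x => ?_)
    simp [hg_def]
  -- spectral form of the gradient norm
  have hG := tsum_freqNormSq_mul_enorm_sq_mFourierCoeff_complexify hv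
  -- pointwise comparison of the two series
  have hpt : ∀ k : d → ℤ, ENNReal.ofReal (((K : ℝ) + 1) ^ 2) * ‖mFourierCoeff g k‖ₑ ^ 2 ≤
      ENNReal.ofReal (freqNormSq k) * ‖mFourierCoeff g k‖ₑ ^ 2 := by
    intro k
    by_cases hk : ∀ i, |k i| ≤ K
    · have h0 : mFourierCoeff g k = 0 := hK k hk
      simp [h0]
    · have h1 := ENNReal.ofReal_le_ofReal (sq_succ_le_freqNormSq (d := d) hk)
      gcongr
  have hle : ENNReal.ofReal (((K : ℝ) + 1) ^ 2) * ENNReal.ofReal (∫ x, ‖v x‖ ^ 2) ≤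
      ENNReal.ofReal ((4 * Real.pi ^ 2)⁻¹ * gradNormSq v) := by
    rw [← hP, ← ENNReal.tsum_mul_left, ← hG]
    exact ENNReal.tsum_le_tsum hpt
  have hI0 : 0 ≤ ∫ x, ‖v x‖ ^ 2 := integral_nonneg fun _ => sq_nonneg _
  have hgrad0 : 0 ≤ gradNormSq v := gradNormSq_nonneg v
  rw [← ENNReal.ofReal_mul (by positivity),
    ENNReal.ofReal_le_ofReal_iff (by positivity)] at hle
  -- clear the factor `(4π²)⁻¹`
  have hπ : (0 : ℝ) < 4 * Real.pi ^ 2 := by positivity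
  have h2 := mul_le_mul_of_nonneg_left hle hπ.le
  have h3 : 4 * Real.pi ^ 2 * ((4 * Real.pi ^ 2)⁻¹ * gradNormSq v) = gradNormSq v := by
    field_simp
  calc 4 * Real.pi ^ 2 * ((K : ℝ) + 1) ^ 2 * ∫ x, ‖v x‖ ^ 2
      = 4 * Real.pi ^ 2 * (((K : ℝ) + 1) ^ 2 * ∫ x, ‖v x‖ ^ 2) := by ring
    _ ≤ 4 * Real.pi ^ 2 * ((4 * Real.pi ^ 2)⁻¹ * gradNormSq v) := h2
    _ = gradNormSq v := h3

/-! ## §2 Coercivity: a high-frequency neutral mode forces a large strain bound -/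

/-- **Coercivity corollary** (STRATEGY-CENSUS W2, kernel-checked core).  If a smooth real field `v` has
no Fourier modes in `box K`, satisfies an energy inequality `ν‖∇v‖₂² ≤ M ∫‖v‖²` with `ν ≥ 0` (the shape
of the energy identity of a neutral mode of the linearised Navier–Stokes operator, `M` bounding the
symmetric velocity gradient of the base flow in `L^∞`), and is non-zero in `L²`, then
`4π²ν(K+1)² ≤ M`: first-order invisibility with respect to the stock `box K` costs a strain Reynolds
number `M/(4π²ν) ≥ (K+1)²`. [folklore] -/
theorem coercivity_of_energy_le {v : UnitAddTorus d → EuclideanSpace ℝ d} (hv : IsSmooth v) (K : ℕ)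
    (hK : ∀ k : d → ℤ, (∀ i, |k i| ≤ K) → mFourierCoeff (EuclideanSpace.complexify ∘ v) k = 0)
    {ν M : ℝ} (hν : 0 ≤ ν) (hM : ν * gradNormSq v ≤ M * ∫ x, ‖v x‖ ^ 2)
    (hv0 : 0 < ∫ x, ‖v x‖ ^ 2) :
    4 * Real.pi ^ 2 * ν * ((K : ℝ) + 1) ^ 2 ≤ M := by
  have hP := highMode_poincare hv K hK
  -- `ν · 4π²(K+1)² ∫‖v‖² ≤ ν‖∇v‖₂² ≤ M ∫‖v‖²`, then cancel `∫‖v‖² > 0`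
  have h1 : 4 * Real.pi ^ 2 * ν * ((K : ℝ) + 1) ^ 2 * ∫ x, ‖v x‖ ^ 2 ≤ M * ∫ x, ‖v x‖ ^ 2 := by
    calc 4 * Real.pi ^ 2 * ν * ((K : ℝ) + 1) ^ 2 * ∫ x, ‖v x‖ ^ 2
        = ν * (4 * Real.pi ^ 2 * ((K : ℝ) + 1) ^ 2 * ∫ x, ‖v x‖ ^ 2) := by ring
      _ ≤ ν * gradNormSq v := mul_le_mul_of_nonneg_left hP hν
      _ ≤ M * ∫ x, ‖v x‖ ^ 2 := hM
  exact le_of_mul_le_mul_right h1 hv0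

/-- The same corollary read as a LOWER BOUND ON THE STOCK needed for visibility: if the strain bound is
below `4π²ν(K+1)²`, a non-zero field with the energy inequality has a Fourier mode inside `box K`.
[folklore] -/
theorem exists_mode_in_box_of_lt {v : UnitAddTorus d → EuclideanSpace ℝ d} (hv : IsSmooth v) (K : ℕ)
    {ν M : ℝ} (hν : 0 ≤ ν) (hM : ν * gradNormSq v ≤ M * ∫ x, ‖v x‖ ^ 2)
    (hv0 : 0 < ∫ x, ‖v x‖ ^ 2) (hlt : M < 4 * Real.pi ^ 2 * ν * ((K : ℝ) + 1) ^ 2) :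
    ∃ k : d → ℤ, (∀ i, |k i| ≤ K) ∧ mFourierCoeff (EuclideanSpace.complexify ∘ v) k ≠ 0 := by
  by_contra h
  push Not at h
  exact absurd (coercivity_of_energy_le hv K h hν hM hv0) (not_le.2 hlt)

/-! ## §3 The Navier–Stokes instance: real neutral modes of the linearisation at a steady state -/

/-- **Energy identity of the linearised steady Navier–Stokes equation.**  If `u₀` is a smooth
divergence-free base flow and the smooth divergence-free real field `v` with smooth pressure `q`
solves `νΔv − (u₀·∇)v − (v·∇)u₀ − ∇q = 0` pointwise on `T^d` (a real neutral mode of the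
linearisation `L(ν,u₀)`, cf. `Literature.Analysis.FluidPDE.Torus.linearizedNSOperator`), then
`ν‖∇v‖₂² = −∫⟪(v·∇)u₀, v⟫`: testing against `v`, the transport term `∫⟪(u₀·∇)v, v⟫` vanishes by
antisymmetry (`div u₀ = 0`) and the pressure term by `div v = 0` (Temam 1979, Ch. II §1 Lemma 1.3;
Constantin–Foias 1988, Ch. 7). [folklore] -/
theorem linearised_energy_identity {ν : ℝ} {u₀ v : UnitAddTorus d → EuclideanSpace ℝ d}
    {q : UnitAddTorus d → ℝ} (hu : IsSmooth u₀) (hudiv : IsDivFree u₀) (hv : IsSmooth v)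
    (hvdiv : IsDivFree v) (hq : IsSmooth q)
    (hlin : ∀ x, ν • laplacian v x - (convect u₀ v x + convect v u₀ x) - Torus.gradient q x = 0) :
    ν * gradNormSq v = -∫ x, ⟪convect v u₀ x, v x⟫ := by
  -- the four space integrals
  have hΔ : ∫ x, ⟪laplacian v x, v x⟫ = -gradNormSq v := by
    have hint : ∀ i, Integrable (fun x => ‖partialDeriv i v x‖ ^ 2) volume := fun i =>
      ((hv.partialDeriv i).continuous.norm.pow 2).integrable_unitAddTorus
    have h1 := integral_inner_laplacian_eq_neg_holds hv
    rw [gradNormSq, integral_finsetSum _ fun i _ => hint i, ← h1]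
    exact integral_congr_ae (ae_of_all _ fun x => real_inner_comm _ _)
  have hT : ∫ x, ⟪convect u₀ v x, v x⟫ = 0 := by
    have h1 := integral_inner_convect_eq_neg hu hudiv hv hv
    have h2 : ∫ x, ⟪v x, convect u₀ v x⟫ = ∫ x, ⟪convect u₀ v x, v x⟫ :=
      integral_congr_ae (ae_of_all _ fun x => real_inner_comm _ _)
    linarith
  have hP : ∫ x, ⟪Torus.gradient q x, v x⟫ = 0 := integral_inner_gradient_eq_zero_of_isDivFree hv hq hvdiv
  -- test the equation against `v` and integrate
  have e : ∀ x, ν * ⟪laplacian v x, v x⟫ - ⟪convect u₀ v x, v x⟫ - ⟪convect v u₀ x, v x⟫ -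
      ⟪Torus.gradient q x, v x⟫ = 0 := fun x => by
    have h1 := congrArg (fun w => ⟪w, v x⟫) (hlin x)
    simp only [inner_sub_left, inner_add_left, real_inner_smul_left, inner_zero_left] at h1
    linarith
  have i1 : Integrable (fun x => ν * ⟪laplacian v x, v x⟫) volume :=
    (hv.laplacian.inner hv).integrable.const_mul ν
  have i2 : Integrable (fun x => ⟪convect u₀ v x, v x⟫) volume := ((hu.convect hv).inner hv).integrable
  have i3 : Integrable (fun x => ⟪convect v u₀ x, v x⟫) volume := ((hv.convect hu).inner hv).integrable
  have i4 : Integrable (fun x => ⟪Torus.gradient q x, v x⟫) volume := (hq.gradient.inner hv).integrable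
  have i12 : Integrable (fun x => ν * ⟪laplacian v x, v x⟫ - ⟪convect u₀ v x, v x⟫) volume :=
    i1.sub i2
  have i123 : Integrable
      (fun x => ν * ⟪laplacian v x, v x⟫ - ⟪convect u₀ v x, v x⟫ - ⟪convect v u₀ x, v x⟫) volume :=
    i12.sub i3
  have hI : ∫ x, (ν * ⟪laplacian v x, v x⟫ - ⟪convect u₀ v x, v x⟫ - ⟪convect v u₀ x, v x⟫ -
      ⟪Torus.gradient q x, v x⟫) = 0 := by
    rw [integral_congr_ae (ae_of_all _ e), integral_zero]
  rw [integral_sub i123 i4, integral_sub i12 i3, integral_sub i1 i2,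
    integral_const_mul, hΔ, hT, hP] at hI
  linarith

/-- **Energy inequality from a one-sided strain bound.**  Under the hypotheses of
`linearised_energy_identity`, if the velocity gradient of the base flow satisfies
`⟪Du₀(x)ξ, ξ⟫ ≥ −M‖ξ‖²` for all `x, ξ` (e.g. `M = ‖(∇u₀)_sym‖_∞`, the maximal compression rate), then
`ν‖∇v‖₂² ≤ M ∫‖v‖²`. [folklore] -/
theorem linearised_energy_le {ν M : ℝ} {u₀ v : UnitAddTorus d → EuclideanSpace ℝ d}
    {q : UnitAddTorus d → ℝ} (hu : IsSmooth u₀) (hudiv : IsDivFree u₀) (hv : IsSmooth v)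
    (hvdiv : IsDivFree v) (hq : IsSmooth q)
    (hlin : ∀ x, ν • laplacian v x - (convect u₀ v x + convect v u₀ x) - Torus.gradient q x = 0)
    (hM : ∀ (x : UnitAddTorus d) (ξ : EuclideanSpace ℝ d), -(M * ‖ξ‖ ^ 2) ≤ ⟪Torus.fderiv u₀ x ξ, ξ⟫) :
    ν * gradNormSq v ≤ M * ∫ x, ‖v x‖ ^ 2 := by
  rw [linearised_energy_identity hu hudiv hv hvdiv hq hlin, ← integral_neg, ← integral_const_mul]
  refine integral_mono ((hv.convect hu).inner hv).integrable.neg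
    ((hv.continuous.norm.pow 2).integrable_unitAddTorus.const_mul M) fun x => ?_
  -- pointwise: `−⟪Du₀(x) v(x), v(x)⟫ ≤ M‖v(x)‖²`
  have h1 := hM x (v x)
  show -⟪convect v u₀ x, v x⟫ ≤ M * ‖v x‖ ^ 2
  rw [convect] at *
  linarith

/-- **Neutral modes off the stock force a large strain Reynolds number** (general dimension; the
Navier–Stokes instance of `coercivity_of_energy_le` for the forward kernel).  Let `u₀` be a smooth
divergence-free base flow with one-sided strain bound `⟪Du₀(x)ξ, ξ⟫ ≥ −M‖ξ‖²`, `ν ≥ 0`, and let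
`v ≠ 0` (in `L²`) be a smooth divergence-free real solution of the linearised steady equation
`νΔv − (u₀·∇)v − (v·∇)u₀ − ∇q = 0` whose Fourier coefficients vanish on `box K = {k : |kᵢ| ≤ K ∀ i}`.
Then `4π²ν(K+1)² ≤ M`. [folklore] -/
theorem neutralMode_strain_ge' {ν M : ℝ} {u₀ v : UnitAddTorus d → EuclideanSpace ℝ d}
    {q : UnitAddTorus d → ℝ} (hu : IsSmooth u₀) (hudiv : IsDivFree u₀) (hv : IsSmooth v)
    (hvdiv : IsDivFree v) (hq : IsSmooth q)
    (hlin : ∀ x, ν • laplacian v x - (convect u₀ v x + convect v u₀ x) - Torus.gradient q x = 0)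
    (hM : ∀ (x : UnitAddTorus d) (ξ : EuclideanSpace ℝ d), -(M * ‖ξ‖ ^ 2) ≤ ⟪Torus.fderiv u₀ x ξ, ξ⟫)
    (hν : 0 ≤ ν) (K : ℕ)
    (hK : ∀ k : d → ℤ, (∀ i, |k i| ≤ K) → mFourierCoeff (EuclideanSpace.complexify ∘ v) k = 0)
    (hv0 : 0 < ∫ x, ‖v x‖ ^ 2) :
    4 * Real.pi ^ 2 * ν * ((K : ℝ) + 1) ^ 2 ≤ M :=
  coercivity_of_energy_le hv K hK hν (linearised_energy_le hu hudiv hv hvdiv hq hlin hM) hv0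

/-- **Neutral modes off the stock force a large strain Reynolds number** (STRATEGY-CENSUS W2 on `T³`,
registered sub-goal `neutralMode_strain_ge` of stmt-AnomalousDissipation-1144).  For a smooth
divergence-free base flow `u₀` on `T³` with one-sided strain bound `⟪Du₀(x)ξ, ξ⟫ ≥ −M‖ξ‖²` and `ν ≥ 0`:
every smooth divergence-free real neutral mode `v` of the linearised steady Navier–Stokes operator
(`νΔv − (u₀·∇)v − (v·∇)u₀ − ∇q = 0`) that is non-zero in `L²` and has NO Fourier mode in
`box K = {k : |kᵢ| ≤ K ∀ i}` forces `4π²ν(K+1)² ≤ M`.  Contrapositive: when the strain Reynolds number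
`M/(4π²ν)` is below `(K+1)²`, every non-zero neutral mode is seen by the stock `box K` — the precise,
Reynolds-BOUNDED sense in which a finite stock detects degeneracies, and (since `M/(4π²ν)` is unbounded
on every `LOUD_j(S,E,ε)`, the viscosity being free below the level) why no finite stock does so
uniformly (Foias–Temam's `m ≥ m₁(k,ν)`, LNM 565 p. 26). [folklore] -/
theorem neutralMode_strain_ge : ∀ (ν M : ℝ) (K : ℕ) (u₀ v : UnitAddTorus (Fin 3) → EuclideanSpace ℝ (Fin 3)) (q : UnitAddTorus (Fin 3) → ℝ), IsSmooth u₀ → IsDivFree u₀ → IsSmooth v → IsDivFree v → IsSmooth q → (∀ x, ν • laplacian v x - (convect u₀ v x + convect v u₀ x) - Torus.gradient q x = 0) → (∀ (x : UnitAddTorus (Fin 3)) (ξ : EuclideanSpace ℝ (Fin 3)), -(M * ‖ξ‖ ^ 2) ≤ inner ℝ (Torus.fderiv u₀ x ξ) ξ) → 0 ≤ ν → (∀ k : Fin 3 → ℤ, (∀ i, |k i| ≤ (K : ℤ)) → UnitAddTorus.mFourierCoeff (EuclideanSpace.complexify ∘ v) k = 0) → 0 < (∫ x, ‖v x‖ ^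 2) → 4 * Real.pi ^ 2 * ν * ((K : ℝ) + 1) ^ 2 ≤ M :=
  fun _ν _M K _u₀ _v _q hu hudiv hv hvdiv hq hlin hM hν hK hv0 =>
    neutralMode_strain_ge' hu hudiv hv hvdiv hq hlin hM hν K hK hv0

end Summit.AnomalousDissipation.AnomalousDissipation.Theorems.RobustLoudUpgrade.Coercivity

end
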